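import Summits.QuantumFields.YangMills.Theorems.LangevinControlUVOSLegsAtWeakCouplingCDefs
import Summits.QuantumFields.YangMills.Theorems.LangevinControlUVOSLegsAtWeakCouplingCStubDensity
import Summits.QuantumFields.YangMills.Theorems.LangevinControlUVOSLegsAtWeakCouplingCStubCluster
import Summits.QuantumFields.YangMills.Theorems.LangevinControlUVOSLegsFromFemtoAndGapStubGap
import Summits.QuantumFields.YangMills.Theorems.LangevinControlUVOSLegsFromFemtoAndGapStubGrowth
import Summits.QuantumFields.YangMills.Theorems.LangevinControlUVOSLegsFromFemtoAndGapStubLower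
import Summits.QuantumFields.YangMills.Theorems.LangevinControlUVOSLegsFromFemtoAndGapStubCollar6
import Summits.QuantumFields.YangMills.Theorems.LangevinControlUVOSLegsFromFemtoAndGapStubPinOfContinuous
import Summits.QuantumFields.YangMills.Theorems.LangevinControlUVOSLegsFromFemtoAndGapStubAssemblyHermitian
import Summits.QuantumFields.YangMills.Theorems.LangevinControlUVOSLegsFromFemtoAndGapStubAssemblyPlaneExpansion
import Summits.QuantumFields.YangMills.Theorems.OSLegsFromFemtoAndGap.Negative.UnitsAndGapFree
import Summits.QuantumFields.YangMills.Theorems.HypercubicLimit.Negative.OneFieldReduction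
import Summits.QuantumFields.YangMills.Theorems.PencilRigidityPlanarToEuclidean
import Summits.QuantumFields.YangMills.Theorems.LangevinControlUVOSLegsAtWeakCouplingCFblOfFbl6
import Summits.QuantumFields.YangMills.Theorems.LangevinControlUVOSLegsAtWeakCouplingCStubLocality
import HarnessLib

/-!
# Crux `OSLegsAtWeakCouplingC` (stmt-QuantumFields-16207), line `Sketch`: the composition, conditional on the line's stubs

Support file (lead c2): the composition of line `Sketch` as a CONDITIONAL theorem in the tree —
`osLegsAtWeakCouplingC_of_imports : Statement.stub_fcp6 → Statement.stub_rope → Statement.stub_hypercubic →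
Statement.stub_germ → OSLegsAtWeakCouplingC` (sorry-free; the crux BY NAME from the four remaining registered stub
statements of the skeleton `Cruxes/OSLegsAtWeakCouplingC/Lines/Sketch.lean`).  Everything else the line needs is landed and
used by name: `stubPin_of_continuous`, `stub_collar6`, `fbl_of_fbl6`, `stub_lower`, `stub_growth`, `stub_gap`,
`stub_cluster`, `stub_density`, `stub_locality` (lead c2, …StubLocality), `isHermitian_of_isReflectionPositive`,
`PlanarToEuclidean_proof` (Givens generation of `SO(4)`), the extension by zero along `onlySpecies`.
Of the four hypotheses, `stub_hypercubic` and `stub_rope` are proved in files pending at the gate (farm taint), while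
`stub_fcp6` (periodic → frozen-boundary femto package) and `stub_germ` (E1 on the germ along weak-coupling bundles) are
the line's declared dynamical imports.

Card `Cruxes/OSLegsAtWeakCouplingC/Ideas/axis-cross-analyticity-e1-locality.md`; refs OsterwalderSchrader1975,
GlimmJaffe1987 §6.1/§19, JaffeWitten2000 §4/§6.
-/

set_option autoImplicit false

noncomputable section

open scoped SchwartzMap ComplexConjugate BigOperators
open MeasureTheory Filter Topology
open Literature.MathematicalPhysics.QuantumFieldTheory Literature.MathematicalPhysics.QuantumLattice
open Literature.MathematicalPhysics.AQFT Literature.Probability.LatticeModels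
open Summit.QuantumFields.YangMills.Theses.LangevinControlUV (OSLegsAtWeakCouplingC)
open Summit.QuantumFields.YangMills.Cruxes.OSLegsFromFemtoAndGap.DlrCollarTransfer
open Summit.QuantumFields.YangMills.Theorems.OSLegsFromFemtoAndGap
  (isHermitian_of_isReflectionPositive dens_eq_sum_filter_plane card_planes)
open Summit.QuantumFields.YangMills.Theorems.HypercubicLimit.Negative (onlySpecies extendByZero)
open Summit.QuantumFields.YangMills.Theorems (PlanarToEuclidean_proof)

namespace Summit.QuantumFields.YangMills.Cruxes.OSLegsAtWeakCouplingC.Sketch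

/-! ## §2 Glue: `FBL6 ⇒ FBL` is landed (`DlrCollarTransfer.fbl_of_fbl6`, p127531) -/

/-! ## §3 One OS field extended by zero to all species (tree `extendByZero` / `onlySpecies`) -/

section Extension

open Summit.QuantumFields.YangMills.Theorems.HypercubicLimit.Negative

variable {G : Type} [Group G] [TopologicalSpace G] [IsTopologicalGroup G] [CompactSpace G]
  [MeasurableSpace G] [BorelSpace G]

/-- **One OS field is Yang–Mills OS data along the silenced scheme**: a one-field OS family `S₁` towards which the
renormalised curvature strings converge along `sch`, non-trivial and non-Gaussian, extends by zero to
`OSData (YMSpecies G) 4` with `IsYangMillsFor r (onlySpecies sch r.curvature)`, `IsNontrivial` and `IsNonGaussian`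
of the curvature (bookkeeping; the model is `CriticalContinuumLimit.stub_oneFieldExtension`). -/
theorem exists_osData_of_oneField (r : LatticeRep G) (sch : SpeciesScheme (YMSpecies G))
    (S₁ : SchwingerFamily (EuclideanSpace ℝ (Fin 4))) (hOS : OSAxiomsSchwinger S₁.toLabelled)
    (hconv : ∀ (n : ℕ), n ≠ 0 → ∀ (f : Fin n → 𝓢((EuclideanSpace ℝ (Fin 4)), ℝ)) (F : 𝓢((Fin n → (EuclideanSpace ℝ (Fin 4))), ℂ)),
      IsTensorOf F (fun i => ofRealTest (f i)) → IsOffDiagonal F →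
        Tendsto (fun k : ℕ =>
          ((latticeSchwinger r.ρ sch (fun s => s.F) k n (fun _ => r.curvature) f : ℝ) : ℂ))
          atTop (𝓝 (S₁ n F)))
    (hnt : ∃ (F₁ G₁ : 𝓢((Fin 1 → (EuclideanSpace ℝ (Fin 4))), ℂ)) (H₁ : 𝓢((Fin (1 + 1) → (EuclideanSpace ℝ (Fin 4))), ℂ)),
      IsTimeOrdered F₁ ∧ IsTimeOrdered G₁ ∧ IsAppendTensorOf H₁ (osAdjoint F₁) G₁ ∧
        S₁ (1 + 1) H₁ ≠ S₁ 1 (osAdjoint F₁) * S₁ 1 G₁)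
    (hng : ∃ (f g h : 𝓢((EuclideanSpace ℝ (Fin 4)), ℂ)) (Ffgh : 𝓢((Fin 3 → (EuclideanSpace ℝ (Fin 4))), ℂ)) (Fgh Ffh Ffg : 𝓢((Fin 2 → (EuclideanSpace ℝ (Fin 4))), ℂ))
      (Ff Fg Fh : 𝓢((Fin 1 → (EuclideanSpace ℝ (Fin 4))), ℂ)),
      IsTensorOf Ffgh ![f, g, h] ∧ IsOffDiagonal Ffgh ∧ IsTensorOf Fgh ![g, h] ∧
      IsTensorOf Ffh ![f, h] ∧ IsTensorOf Ffg ![f, g] ∧ IsTensorOf Ff ![f] ∧ IsTensorOf Fg ![g] ∧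
      IsTensorOf Fh ![h] ∧
        S₁ 3 Ffgh - S₁ 1 Ff * S₁ 2 Fgh - S₁ 1 Fg * S₁ 2 Ffh - S₁ 1 Fh * S₁ 2 Ffg +
          2 * (S₁ 1 Ff * S₁ 1 Fg * S₁ 1 Fh) ≠ 0) :
    ∃ T : OSData (YMSpecies G) 4,
      IsYangMillsFor r (onlySpecies sch r.curvature) T ∧ T.IsNontrivial r.curvature ∧
        T.IsNonGaussian r.curvature := by
  -- the OS axioms pass to the extension by zero (E1: on a constant label string it is `S₁`'s invariance, on any other
  -- string both sides vanish; the other axioms by the tree's `ExtendByZero` lemmas)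
  have hE1 : (extendByZero r.curvature S₁).IsEuclideanInvariant := by
    refine ⟨fun n k a F hF => ?_, fun n k R hR F hF => ?_⟩
    · by_cases hk : ∀ i, k i = r.curvature
      · rw [extendByZero_of_all r.curvature S₁ hk]; exact hOS.invariant.1 n (fun _ => ()) a F hF
      · rw [extendByZero_of_not_all r.curvature S₁ hk]; rfl
    · by_cases hk : ∀ i, k i = r.curvature
      · rw [extendByZero_of_all r.curvature S₁ hk]; exact hOS.invariant.2 n (fun _ => ()) R hR F hF
      · rw [extendByZero_of_not_all r.curvature S₁ hk]; rfl
  have hOS' : OSAxiomsSchwinger (extendByZero r.curvature S₁) :=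
    { normalized := isNormalized_extendByZero hOS.normalized
      hermitian := isHermitian_extendByZero hOS.hermitian
      invariant := hE1
      reflectionPositive := isReflectionPositive_extendByZero hOS.reflectionPositive
      symmetric := isSymmetric_extendByZero hOS.symmetric
      cluster := hasClusterProperty_extendByZero hOS.cluster
      linearGrowth := hasLinearGrowth_extendByZero hOS.linearGrowth }
  refine ⟨OSData.ofAxioms (extendByZero r.curvature S₁) hOS', ?_, ?_, ?_⟩
  · intro n hn σ f F hF hod
    rw [OSData.ofAxioms_schwinger]
    by_cases hσ : ∀ i, σ i = r.curvature
    · obtain rfl : σ = fun _ => r.curvature := funext hσ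
      rw [extendByZero_const]
      simp_rw [latticeSchwinger_onlySpecies_self]
      exact hconv n hn f F hF hod
    · obtain ⟨i₀, hi₀⟩ := not_forall.mp hσ
      rw [extendByZero_of_not_all _ _ (fun hall => hi₀ (hall i₀))]
      simp_rw [latticeSchwinger_onlySpecies_of_ne r sch r.curvature _ n σ f hi₀]
      simp
  · unfold OSData.IsNontrivial
    simpa using hnt
  · unfold OSData.IsNonGaussian
    simpa using hng

end Extension

/-! ## §4 The composition -/

section Composition

variable {G : Type} [Group G] [TopologicalSpace G] [IsTopologicalGroup G] [CompactSpace G]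
  [MeasurableSpace G] [BorelSpace G]

/-- **Rotation half of E1 from signed permutations and planar isometries** (Givens generation of `SO(4)`,
`PlanarToEuclidean_proof`). -/
theorem isEuclideanInvariant_of_planar (S₁ : SchwingerFamily (EuclideanSpace ℝ (Fin 4)))
    (htrans : ∀ (n : ℕ) (t : (EuclideanSpace ℝ (Fin 4))) (F : 𝓢((Fin n → (EuclideanSpace ℝ (Fin 4))), ℂ)), IsOffDiagonal F → S₁ n (translateMulti t F) = S₁ n F)
    (hsigned : ∀ R : (EuclideanSpace ℝ (Fin 4)) ≃ₗᵢ[ℝ] (EuclideanSpace ℝ (Fin 4)), IsSignedPerm R → Invariant S₁ R)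
    (hplanar : ∀ R : (EuclideanSpace ℝ (Fin 4)) ≃ₗᵢ[ℝ] (EuclideanSpace ℝ (Fin 4)), IsPlanar01 R → Invariant S₁ R) :
    S₁.toLabelled.IsEuclideanInvariant := by
  refine ⟨fun n _ t F hF => htrans n t F hF, fun n k R hR F hF => ?_⟩
  exact PlanarToEuclidean_proof Unit S₁.toLabelled (fun n k R _ hR F hF => hsigned R hR n F hF)
    (fun R _ h2 h3 n k F hF => hplanar R ⟨h2, h3⟩ n F hF) n k R hR F hF

/-- **The line, composed**: the five stubs give `ConclC` for every compact simple `G`, every `r`, every CONTINUOUS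
unit map `a` carrying H1, H2, H3. -/
theorem conclC_of_stubs (hfcp : Statement.stub_fcp6) (hrope : Statement.stub_rope)
    (hhyp : Statement.stub_hypercubic) (hgerm : Statement.stub_germ) (hloc : Statement.stub_locality)
    (hG : IsCompactSimpleLieGroup G) (r : LatticeRep G) (a : ℝ → ℝ) (ha : Continuous a)
    (h1 : TwoPoint G r a) (h2 : Skewness G r a) (h3 : GapInUnits G r a) : ConclC G r a := by
  -- positivity and the limit of the unit map, from H1
  obtain ⟨-, -, -, -, -, -, -, hapos, ha0, -, -⟩ := id h1
  -- hypothesis side: pin, femto package, collar, lower bounds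
  have hpin : TwoPointPinned G r a := stubPin_of_continuous G hG r a ha h1 h3
  obtain ⟨hFBL6, hFC2, hFC3⟩ := hfcp G hG r a hpin h2
  have hMB6 : MomentBounds6 G r a := stub_collar6 G r a hFBL6
  have hLB : LowerBounds G r a := stub_lower G r a hapos ha0 (fbl_of_fbl6 r a hFBL6) hFC2 hFC3
  -- the rope's demands, then the soft bundle meeting them
  obtain ⟨b₀, g, Δ, hΔ, hRD⟩ := hrope G r a hapos ha0 h3
  obtain ⟨sch, S₁, Tq, K, hB⟩ := stub_growth G r a hapos ha0 hMB6 hLB h3 b₀ g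
  obtain ⟨hRP, hDec⟩ := hRD sch S₁ Tq K hB
  have hsigned : ∀ R : (EuclideanSpace ℝ (Fin 4)) ≃ₗᵢ[ℝ] (EuclideanSpace ℝ (Fin 4)), IsSignedPerm R → Invariant S₁ R :=
    fun R hR n F hF => hhyp G r a sch S₁ Tq K b₀ g hB n R hR F hF
  have hdens : OffDiagDensity S₁ := stub_density G r a sch S₁ Tq K b₀ g hMB6 hB
  obtain ⟨r₀, hr₀, hgermR⟩ := hgerm G hG r a sch S₁ Tq K b₀ g ha h1 h3 hB
  -- unpack the bundle
  obtain ⟨⟨hunits, -, -, hβ, hN, hLG, hE3, htrans, h0, h1', -, -, hYM, hnt, hng, ⟨Δ', hΔ', hlat⟩, -⟩, -⟩ := hB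
  -- continuum side
  obtain ⟨hCS, hgapOf⟩ := stub_gap S₁ h0 htrans hRP
  have hE4 : S₁.toLabelled.HasClusterProperty :=
    stub_cluster S₁ Δ hΔ h0 h1' htrans (fun n R hR F hF => hsigned R hR n F hF) hCS hDec
  have hplanar : ∀ R : (EuclideanSpace ℝ (Fin 4)) ≃ₗᵢ[ℝ] (EuclideanSpace ℝ (Fin 4)), IsPlanar01 R → Invariant S₁ R := fun R hR =>
    hloc S₁ h0 htrans hE3 hLG hRP hsigned hdens R hR r₀ hr₀ (hgermR R hR)
  have hE1 : S₁.toLabelled.IsEuclideanInvariant := isEuclideanInvariant_of_planar S₁ htrans hsigned hplanar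
  have hE2 : S₁.toLabelled.IsReflectionPositive := isReflectionPositive_of_rpPos hRP
  have hherm : S₁.toLabelled.IsHermitian := isHermitian_of_isReflectionPositive S₁ hN hE2
  have hOS : OSAxiomsSchwinger S₁.toLabelled :=
    { normalized := hN, hermitian := hherm, invariant := hE1, reflectionPositive := hE2, symmetric := hE3,
      cluster := hE4, linearGrowth := hLG }
  have hgap : S₁.toLabelled.HasMassGap Δ := hgapOf Δ hΔ hDec
  -- one field extended by zero to all species
  have hnt' : ∃ (F₁ G₁ : 𝓢((Fin 1 → (EuclideanSpace ℝ (Fin 4))), ℂ)) (H₁ : 𝓢((Fin (1 + 1) → (EuclideanSpace ℝ (Fin 4))), ℂ)),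
      IsTimeOrdered F₁ ∧ IsTimeOrdered G₁ ∧ IsAppendTensorOf H₁ (osAdjoint F₁) G₁ ∧
        S₁ (1 + 1) H₁ ≠ S₁ 1 (osAdjoint F₁) * S₁ 1 G₁ := by
    simpa using hnt
  have hng' : ∃ (f g h : 𝓢((EuclideanSpace ℝ (Fin 4)), ℂ)) (Ffgh : 𝓢((Fin 3 → (EuclideanSpace ℝ (Fin 4))), ℂ)) (Fgh Ffh Ffg : 𝓢((Fin 2 → (EuclideanSpace ℝ (Fin 4))), ℂ))
      (Ff Fg Fh : 𝓢((Fin 1 → (EuclideanSpace ℝ (Fin 4))), ℂ)),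
      IsTensorOf Ffgh ![f, g, h] ∧ IsOffDiagonal Ffgh ∧ IsTensorOf Fgh ![g, h] ∧
      IsTensorOf Ffh ![f, h] ∧ IsTensorOf Ffg ![f, g] ∧ IsTensorOf Ff ![f] ∧ IsTensorOf Fg ![g] ∧
      IsTensorOf Fh ![h] ∧
        S₁ 3 Ffgh - S₁ 1 Ff * S₁ 2 Fgh - S₁ 1 Fg * S₁ 2 Ffh - S₁ 1 Fh * S₁ 2 Ffg +
          2 * (S₁ 1 Ff * S₁ 1 Fg * S₁ 1 Fh) ≠ 0 := by
    simpa using hng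
  obtain ⟨T, hYM', hntT, hngT⟩ := exists_osData_of_oneField r sch S₁ hOS hYM hnt' hng'
  exact ⟨onlySpecies sch r.curvature, T, hunits, hβ, hYM', hntT, hngT, Δ', hΔ', hlat⟩

end Composition

/-- **The crux from the line's four remaining stub statements** (conditional result): `OSLegsAtWeakCouplingC` BY
NAME from `stub_fcp6` (import), `stub_rope`, `stub_hypercubic`, `stub_germ` (import). -/
theorem osLegsAtWeakCouplingC_of_imports (hfcp : Statement.stub_fcp6) (hrope : Statement.stub_rope) (hhyp : Statement.stub_hypercubic) (hgerm : Statement.stub_germ) : OSLegsAtWeakCouplingC := by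
  rw [cruxC_iff]
  intro G _ _ _ _ hG
  letI : MeasurableSpace G := borel G
  haveI : BorelSpace G := ⟨rfl⟩
  intro r a ha h1 h2 h3
  exact conclC_of_stubs hfcp hrope hhyp hgerm stub_locality hG r a ha h1 h2 h3

end Summit.QuantumFields.YangMills.Cruxes.OSLegsAtWeakCouplingC.Sketch

end
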